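import Summits.QuantumFields.BalabanUV.Beta.EriceFlowEnclosureB12AsPrintedHistoryContagionShiftFlowZeroTangentLambda

/-!
# Beta / EriceFlowEnclosureB12AsPrintedHistoryContagionShiftFlowZeroTangentWitness — ASYMPTOTIC FREEDOM IS CONTAGIOUS, part 73: THE C¹ SHAPE IS EXACTLY WHAT THE KINK LACKS,
# AND IT IS INHABITED.  Part 62 (#73i) exhibited the def-free kink functional `B(u) = 1 + min(u₀, a)` — memory profile `C_m = 1`, value 1 at the zero history — whose
# Λ-coordinate is NOT differentiable at two couplings (part 63 inhabited it with all of node U2's hypotheses): «almost every» is optimal on the Lipschitz class.  Parts 68–72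
# proved that part 68's C¹ shape (gradient with the memory profile `hG`, uniform first-order remainder `hGB`, continuity of the gradient `hGc`) gives a C¹ Λ-coordinate and a
# Gell-Mann–Low equation at every scale.  This file closes the circle, def-free: (§125) **THE KINK FUNCTIONAL ADMITS NO GRADIENT** — for `0 < a < γ` NO `G` satisfies the
# remainder letter `hGB` for `u ↦ 1 + min(u₀, a)` (at the constant history a, the one-sided increments ±τe₀ force `|G₀| ≤ 1∕4` and `|1 − G₀| ≤ 1∕4`): the hypothesis of
# parts 68–72 fails EXACTLY for the witness of parts 62–63, as it must; (§126) **THE SHAPE IS INHABITED**: the constant functional (`G ≡ 0`; its tangent flow is `W ≡ 1` at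
# every pin BY THE EQUATION, so `W_∞ = 1` and `Λ′(e) = −2∕e³` for every dynamical Abel function of a constant flow — part 61's (#73h) closed form recovered from the tangent
# flow), and the NON-CONSTANT one-step functional **`B(u) = c + κ₀u₀²`** (`G u 0 = 2κ₀u₀`, else 0): memory profile `2|κ₀|γ`, remainder `κ₀(u′₀ − u₀)²`, gradient
# `2|κ₀|`-Lipschitz — all three letters, with explicit ρ(ε) (β-flow team, prover 1, unit `b2b-balaban-beta-bflow-p1`, gen 42; ROW AP-I·Uc × NODE U2)

HONEST FRAMING (page 1 of everything the β sub-cell writes): discharging `BetaPertH` makes Bałaban's UV stability UNCONDITIONAL — a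
real constructive-QFT result; it is NOT the continuum limit and NOT the Clay problem.  HONEST DEPENDENCY (cell reorg 2026-08-19,
verbatim): «continuum YM on T⁴ ⇐ BetaPertH ∧ nine spine estimates (0/9 proved); BetaPertH ⇐ (D1) ∧ (D4) ∧ CAP+tail; G-an2-4 gates
asym, D1 and NE2/3/4.»  THIS MODULE DISCHARGES NOTHING: [folklore] one-variable calculus on two TOY functionals and the kink (ours, def-free; NOT Bałaban's β) over node U2's
HYPOTHESIS SHAPE `T4BetaStationary.SeqBox ∕ MemoryProfile` consumed BY NAME (NOT PRINTED for [I] = T. Bałaban, Commun. Math. Phys. **109** (1987) [Balaban1987RG1]: p. 298,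
(0.20) p. 256, Theorem 2 (0.31) p. 259 STATED WITHOUT PROOF).  Nothing of Bałaban's β is asserted.

WHAT THIS FILE PROVES (0 sorry, 0 def): §125 `tsum_single_zero`, **`kink_no_gradient`**; §126 `const_letters`, **`const_tangent`**, **`const_deriv_dynAbel`**, `quad_memoryProfile`,
**`quad_letters`**.  NOT CLAIMED: that Bałaban's β_k supply the C¹ shape in the limit; anything about Bałaban's β; `BetaPertH`; the continuum limit of the measures; Clay.
-/

namespace Summit.QuantumFields.BalabanUV.Beta.EriceFlowEnclosureB12AsPrintedHistoryContagionShiftFlowZeroTangentWitness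

open Finset Filter Topology Set
open Literature.MathematicalPhysics.QuantumFieldTheory.Balaban1983to89
open Literature.MathematicalPhysics.QuantumFieldTheory.Balaban1983to89.T4BetaStationary (SeqBox MemoryProfile summable_profile)
open Literature.MathematicalPhysics.QuantumFieldTheory.Balaban1983to89.T4BetaFlowWellPosed (MemFlow solution)
open Summit.QuantumFields.BalabanUV.Beta.EriceFlowEnclosureB12AsPrintedHistoryContagionShiftFlowZeroTangentLambda (deriv_dynAbel_eq)

noncomputable section

/-! ## §125 The kink functional admits no gradient -/

/-- A series supported at 0: `Σ_j c_j·(if j = 0 then τ else 0) = c_0·τ`. [folklore] -/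
theorem tsum_single_zero (c : ℕ → ℝ) (τ : ℝ) : ∑' j : ℕ, c j * (if j = 0 then τ else 0) = c 0 * τ := by
  rw [tsum_eq_single 0 (fun j hj => by simp [hj])]
  simp

/-- **THE KINK FUNCTIONAL ADMITS NO GRADIENT.**  For `0 < a < γ`, the def-free functional `u ↦ 1 + min(u₀, a)` of part 62 (memory profile 1, value 1 at zero) satisfies part
68's remainder letter `hGB` for NO candidate gradient G (any real θ): at the constant history a, the increments `+τe₀` (no change of B) and `−τe₀` (change −τ) would force
`|G(a) 0| ≤ 1∕4` and `|1 − G(a) 0| ≤ 1∕4`.  So parts 68–72 do not apply to the witness of parts 62–63 — consistently with its non-differentiable Λ. [folklore] -/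
theorem kink_no_gradient {γ a θ : ℝ} (ha : 0 < a) (haγ : a < γ) (G : (ℕ → ℝ) → ℕ → ℝ) :
    ¬ (∀ ε > 0, ∃ ρ > 0, ∀ u u' : ℕ → ℝ, SeqBox γ u → SeqBox γ u' → (∀ j, |u' j - u j| ≤ ρ) →
      |(1 + min (u' 0) a) - (1 + min (u 0) a) - ∑' j, G u j * (u' j - u j)| ≤ ε * ∑' j, θ ^ j * |u' j - u j|) := by
  intro h
  obtain ⟨ρ, hρ, hrem⟩ := h (1 / 4) (by norm_num)
  set τ : ℝ := min ρ (min (a / 2) ((γ - a) / 2)) with hτ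
  have hτ0 : 0 < τ := by rw [hτ]; exact lt_min hρ (lt_min (by linarith) (by linarith))
  have hτρ : τ ≤ ρ := min_le_left _ _
  have hτa : τ ≤ a / 2 := (min_le_right _ _).trans (min_le_left _ _)
  have hτγ : τ ≤ (γ - a) / 2 := (min_le_right _ _).trans (min_le_right _ _)
  set u : ℕ → ℝ := fun _ => a with hu
  have hus : SeqBox γ u := fun _ => ⟨ha, haγ.le⟩
  -- the two perturbed histories u ± τ e₀
  have key : ∀ σ : ℝ, |σ| = τ → |(1 + min (a + σ) a) - (1 + min a a) - G u 0 * σ| ≤ 1 / 4 * τ := by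
    intro σ hσ
    set u' : ℕ → ℝ := fun j => a + if j = 0 then σ else 0 with hu'
    have hσle : |σ| ≤ a / 2 := hσ ▸ hτa
    have hus' : SeqBox γ u' := by
      intro j
      rcases eq_or_ne j 0 with hj | hj
      · simp only [hu', hj, if_true]
        obtain ⟨h1, h2⟩ := abs_le.mp hσle
        constructor <;> linarith [hσ ▸ hτγ, abs_le.mp (le_of_eq hσ)]
      · simp only [hu', hj, if_false, add_zero]; exact ⟨ha, haγ.le⟩
    have hdiff : ∀ j, u' j - u j = if j = 0 then σ else 0 := fun j => by simp only [hu', hu]; ring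
    have hsep : ∀ j, |u' j - u j| ≤ ρ := fun j => by
      rw [hdiff]; split_ifs
      · exact (le_of_eq hσ).trans hτρ
      · rw [abs_zero]; exact hρ.le
    have h1 := hrem u u' hus hus' hsep
    have hlin : ∑' j, G u j * (u' j - u j) = G u 0 * σ := by
      rw [show (fun j => G u j * (u' j - u j)) = fun j => G u j * (if j = 0 then σ else 0) from funext fun j => by rw [hdiff]]
      exact tsum_single_zero _ _
    have hmod : ∑' j, θ ^ j * |u' j - u j| = τ := by
      rw [show (fun j => θ ^ j * |u' j - u j|) = fun j => (fun j => θ ^ j) j * (if j = 0 then τ else 0) from funext fun j => by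
        rw [hdiff]; split_ifs <;> simp [hσ]]
      rw [tsum_single_zero]; simp
    have hu0 : u 0 = a := rfl
    have hu'0 : u' 0 = a + σ := by simp [hu']
    rw [hlin, hmod, hu0, hu'0] at h1
    exact h1
  -- +τ: B does not move ⟹ |G₀| τ ≤ τ/4
  have hplus := key τ (abs_of_pos hτ0)
  rw [min_eq_right (by linarith : a ≤ a + τ), min_self, sub_self, zero_sub, abs_neg, abs_mul, abs_of_pos hτ0] at hplus
  -- −τ: B moves by −τ ⟹ |1 − G₀| τ ≤ τ/4
  have hminus := key (-τ) (by rw [abs_neg, abs_of_pos hτ0])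
  rw [min_eq_left (by linarith : a + -τ ≤ a), min_self,
    show 1 + (a + -τ) - (1 + a) - G u 0 * -τ = -((1 - G u 0) * τ) by ring, abs_neg, abs_mul, abs_of_pos hτ0] at hminus
  have h1 : |G u 0| ≤ 1 / 4 := le_of_mul_le_mul_right (by linarith) hτ0
  have h2 : |1 - G u 0| ≤ 1 / 4 := le_of_mul_le_mul_right (by linarith) hτ0
  have h3 : (1 : ℝ) ≤ |G u 0| + |1 - G u 0| := by
    calc (1 : ℝ) = |G u 0 + (1 - G u 0)| := by simp
      _ ≤ |G u 0| + |1 - G u 0| := abs_add_le _ _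
  linarith

/-! ## §126 The shape is inhabited: constant functionals, and a non-constant one-step functional -/

/-- **CONSTANT FUNCTIONALS CARRY THE C¹ SHAPE WITH `G ≡ 0`**: the gradient profile, the remainder letter and the continuity letter all hold (any `C_m ≥ 0`, any θ ≥ 0).
[folklore] -/
theorem const_letters {γ Cm θ c : ℝ} (hCm : 0 ≤ Cm) (hθ0 : 0 ≤ θ) :
    (∀ u : ℕ → ℝ, SeqBox γ u → ∀ j, |(fun (_ : ℕ → ℝ) (_ : ℕ) => (0 : ℝ)) u j| ≤ Cm * θ ^ j) ∧
      (∀ ε > 0, ∃ ρ > 0, ∀ u u' : ℕ → ℝ, SeqBox γ u → SeqBox γ u' → (∀ j, |u' j - u j| ≤ ρ) →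
        |(fun _ : ℕ → ℝ => c) u' - (fun _ : ℕ → ℝ => c) u - ∑' j, (fun (_ : ℕ → ℝ) (_ : ℕ) => (0 : ℝ)) u j * (u' j - u j)|
          ≤ ε * ∑' j, θ ^ j * |u' j - u j|) ∧
      (∀ ε > 0, ∃ ρ > 0, ∀ u u' : ℕ → ℝ, SeqBox γ u → SeqBox γ u' → (∀ j, |u' j - u j| ≤ ρ) →
        ∀ j, |(fun (_ : ℕ → ℝ) (_ : ℕ) => (0 : ℝ)) u' j - (fun (_ : ℕ → ℝ) (_ : ℕ) => (0 : ℝ)) u j| ≤ ε * θ ^ j) := by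
  refine ⟨fun u _ j => by simp; positivity, fun ε hε => ⟨1, one_pos, fun u u' _ _ _ => ?_⟩, fun ε hε => ⟨1, one_pos, fun u u' _ _ _ j => ?_⟩⟩
  · simp only [zero_mul, tsum_zero, sub_self, abs_zero]
    exact mul_nonneg hε.le (tsum_nonneg fun j => by positivity)
  · simp; positivity

/-- **THE TANGENT FLOW OF A CONSTANT FUNCTIONAL IS `W ≡ 1`** at every pin, by the equation itself (the gradient vanishes): `1 = 1 − Σ Σ 0`; it is bounded by 2 and tends to 1.
[folklore] -/
theorem const_tangent (h : ℕ → ℝ) :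
    (∀ k, (fun _ : ℕ => (1 : ℝ)) k = 1 - ∑ p ∈ range k, ∑' j,
        (fun (_ : ℕ → ℝ) (_ : ℕ) => (0 : ℝ)) (fun i => h (p + 1 + i)) j * ((h (p + 1 + j)) ^ 3 / 2) * (fun _ : ℕ => (1 : ℝ)) (p + 1 + j)) ∧
      (∀ k, |(fun _ : ℕ => (1 : ℝ)) k| ≤ 2) ∧ Tendsto (fun _ : ℕ => (1 : ℝ)) atTop (𝓝 1) :=
  ⟨fun k => by simp, fun k => by norm_num, tendsto_const_nhds⟩

/-- **FOR A CONSTANT FLOW EVERY DYNAMICAL ABEL FUNCTION HAS `Λ′(e) = −2∕e³` ON ]0, e′[** — part 61's (#73h) closed form `Λ = 1∕g² − const` recovered from the tangent flow: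
`W ≡ 1`, `W_∞ = 1`, `Λ′ = −2W_∞∕e³` (part 70).  Package hypotheses for the constant functional are taken as given (part 63 discharges them on explicit data).
[cite: Balaban1987RG1, Thm 2 (0.31) p.259 with (0.20) p.256] -/
theorem const_deriv_dynAbel {Cm θ γ c bs ta gs e' : ℝ} {t : ℕ → ℝ} {a : ℕ → ℝ} {Λ : ℝ → ℝ}
    (hB : MemoryProfile Cm θ γ (fun _ : ℕ → ℝ => c)) (hCm : 0 ≤ Cm) (hθ0 : 0 ≤ θ) (hθ1 : θ < 1) (hbs : 0 < bs) (hta : 0 < ta)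
    (hts : SeqBox γ t) (htf : MemFlow (fun _ : ℕ → ℝ => c) gs t) (hprof : ∀ m : ℕ, 1 / ta ^ 2 + bs * (m : ℝ) ≤ 1 / (t m) ^ 2)
    (hΛ : ∀ e ∈ Ioc (0 : ℝ) e', ∀ h : ℕ → ℝ, SeqBox γ h → MemFlow (fun _ : ℕ → ℝ => c) e h →
      Tendsto (fun n => 1 / h n ^ 2 - a n) atTop (𝓝 (Λ e)))
    (h2e' : 2 * e' ≤ γ) (hs1 : 4 * Cm * e' ≤ bs * (1 - θ))
    (hs2 : e' ^ 2 * (1 / gs ^ 2 + Cm * γ / (1 - θ) ^ 2 + (2 * Cm / ((1 - θ) * bs)) ^ 2) ≤ 3 / 4)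
    (hs4 : 64 * Cm * e' ^ 3 ≤ (1 - θ) ^ 2) (hs5 : Cm * (8 * e' ^ 3 + 16 * e' / bs) ≤ (1 - θ) / 4) {e : ℝ} (he : e ∈ Ioo (0 : ℝ) e') :
    deriv Λ e = -2 / e ^ 3 := by
  obtain ⟨hG, hGB, -⟩ := const_letters (γ := γ) (c := c) hCm hθ0
  obtain ⟨hW, hWM, hT⟩ := const_tangent (solution (fun _ : ℕ → ℝ => c) e)
  have h := (deriv_dynAbel_eq (G := fun (_ : ℕ → ℝ) (_ : ℕ) => (0 : ℝ)) (W := fun _ : ℕ => (1 : ℝ)) hB hCm hθ0 hθ1 hbs hta hts htf hprof hG hGB hΛ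
    h2e' hs1 hs2 hs4 hs5 he hW hWM hT).1
  rw [h]; ring

/-- The one-step quadratic functional `u ↦ c + κ₀u₀²` has node U2's memory profile with `C_m = 2|κ₀|γ` (any θ ∈ [0, 1[). [folklore] -/
theorem quad_memoryProfile {γ θ c κ₀ : ℝ} (hγ : 0 ≤ γ) (hθ0 : 0 ≤ θ) (hθ1 : θ < 1) :
    MemoryProfile (2 * |κ₀| * γ) θ γ (fun u : ℕ → ℝ => c + κ₀ * (u 0) ^ 2) := by
  intro u u' hu hu'
  have hs := summable_profile hθ0 hθ1 hu hu'
  have h0 : θ ^ 0 * |u 0 - u' 0| ≤ ∑' j, θ ^ j * |u j - u' j| :=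
    hs.le_tsum 0 (fun j _ => by positivity)
  rw [pow_zero, one_mul] at h0
  have hsum : |u 0 + u' 0| ≤ 2 * γ := by
    have := (hu 0).1; have := (hu 0).2; have := (hu' 0).1; have := (hu' 0).2
    rw [abs_of_pos (by linarith)]; linarith
  calc |c + κ₀ * (u 0) ^ 2 - (c + κ₀ * (u' 0) ^ 2)| = |κ₀| * (|u 0 + u' 0| * |u 0 - u' 0|) := by
        rw [← abs_mul, ← abs_mul]; congr 1; ring
    _ ≤ |κ₀| * (2 * γ * |u 0 - u' 0|) := mul_le_mul_of_nonneg_left (mul_le_mul_of_nonneg_right hsum (abs_nonneg _)) (abs_nonneg _)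
    _ = 2 * |κ₀| * γ * |u 0 - u' 0| := by ring
    _ ≤ 2 * |κ₀| * γ * ∑' j, θ ^ j * |u j - u' j| := mul_le_mul_of_nonneg_left h0 (by positivity)

/-- **A NON-CONSTANT FUNCTIONAL WITH THE C¹ SHAPE**: `B(u) = c + κ₀u₀²` with gradient `G u 0 = 2κ₀u₀` (other entries 0) satisfies the gradient profile (`C_m = 2|κ₀|γ`), the
uniform remainder letter (`ρ(ε) = ε∕(|κ₀| + 1)`: the remainder is `κ₀(u′₀ − u₀)²`) and the continuity letter (`ρ(ε) = ε∕(2|κ₀| + 1)`) — the hypothesis of parts 68–72 is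
not confined to constants. [folklore] -/
theorem quad_letters {γ θ c κ₀ : ℝ} (hγ : 0 ≤ γ) (hθ0 : 0 ≤ θ) (hθ1 : θ < 1) :
    (∀ u : ℕ → ℝ, SeqBox γ u → ∀ j, |(fun (u : ℕ → ℝ) (j : ℕ) => if j = 0 then 2 * κ₀ * u 0 else 0) u j| ≤ 2 * |κ₀| * γ * θ ^ j) ∧
      (∀ ε > 0, ∃ ρ > 0, ∀ u u' : ℕ → ℝ, SeqBox γ u → SeqBox γ u' → (∀ j, |u' j - u j| ≤ ρ) →
        |(fun u : ℕ → ℝ => c + κ₀ * (u 0) ^ 2) u' - (fun u : ℕ → ℝ => c + κ₀ * (u 0) ^ 2) u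
            - ∑' j, (fun (u : ℕ → ℝ) (j : ℕ) => if j = 0 then 2 * κ₀ * u 0 else 0) u j * (u' j - u j)| ≤ ε * ∑' j, θ ^ j * |u' j - u j|) ∧
      (∀ ε > 0, ∃ ρ > 0, ∀ u u' : ℕ → ℝ, SeqBox γ u → SeqBox γ u' → (∀ j, |u' j - u j| ≤ ρ) →
        ∀ j, |(fun (u : ℕ → ℝ) (j : ℕ) => if j = 0 then 2 * κ₀ * u 0 else 0) u' j
          - (fun (u : ℕ → ℝ) (j : ℕ) => if j = 0 then 2 * κ₀ * u 0 else 0) u j| ≤ ε * θ ^ j) := by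
  refine ⟨fun u hu j => ?_, fun ε hε => ⟨ε / (|κ₀| + 1), by positivity, fun u u' hu hu' hsep => ?_⟩,
    fun ε hε => ⟨ε / (2 * |κ₀| + 1), by positivity, fun u u' hu hu' hsep j => ?_⟩⟩
  · simp only
    split_ifs with hj
    · rw [hj, pow_zero, mul_one, abs_mul, abs_mul, abs_two, abs_of_pos (hu 0).1]
      exact mul_le_mul_of_nonneg_left (hu 0).2 (by positivity)
    · rw [abs_zero]; positivity
  · have hs := summable_profile hθ0 hθ1 hu' hu
    have h0 : θ ^ 0 * |u' 0 - u 0| ≤ ∑' j, θ ^ j * |u' j - u j| := hs.le_tsum 0 (fun j _ => by positivity)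
    rw [pow_zero, one_mul] at h0
    have hlin : ∑' j, (fun (u : ℕ → ℝ) (j : ℕ) => if j = 0 then 2 * κ₀ * u 0 else 0) u j * (u' j - u j) = 2 * κ₀ * u 0 * (u' 0 - u 0) := by
      rw [tsum_eq_single 0 (fun j hj => by simp [hj])]
      simp
    rw [hlin]
    have hrem : (c + κ₀ * (u' 0) ^ 2) - (c + κ₀ * (u 0) ^ 2) - 2 * κ₀ * u 0 * (u' 0 - u 0) = κ₀ * (u' 0 - u 0) ^ 2 := by ring
    simp only []
    rw [hrem, abs_mul, pow_two, abs_mul]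
    have hd := hsep 0
    have hρ1 : |κ₀| * (ε / (|κ₀| + 1)) ≤ ε := by
      rw [mul_div_assoc']; exact div_le_of_le_mul₀ (by positivity) hε.le (by nlinarith [abs_nonneg κ₀])
    calc |κ₀| * (|u' 0 - u 0| * |u' 0 - u 0|) ≤ |κ₀| * (ε / (|κ₀| + 1) * |u' 0 - u 0|) :=
          mul_le_mul_of_nonneg_left (mul_le_mul_of_nonneg_right hd (abs_nonneg _)) (abs_nonneg _)
      _ = |κ₀| * (ε / (|κ₀| + 1)) * |u' 0 - u 0| := by ring
      _ ≤ ε * |u' 0 - u 0| := mul_le_mul_of_nonneg_right hρ1 (abs_nonneg _)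
      _ ≤ ε * ∑' j, θ ^ j * |u' j - u j| := mul_le_mul_of_nonneg_left h0 hε.le
  · simp only
    split_ifs with hj
    · rw [hj, pow_zero, mul_one, show 2 * κ₀ * u' 0 - 2 * κ₀ * u 0 = 2 * κ₀ * (u' 0 - u 0) by ring, abs_mul, abs_mul, abs_two]
      have hd := hsep 0
      calc 2 * |κ₀| * |u' 0 - u 0| ≤ 2 * |κ₀| * (ε / (2 * |κ₀| + 1)) := mul_le_mul_of_nonneg_left hd (by positivity)
        _ ≤ ε := by
            rw [mul_div_assoc']; exact div_le_of_le_mul₀ (by positivity) hε.le (by nlinarith [abs_nonneg κ₀])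
    · rw [sub_self, abs_zero]; positivity

end

end Summit.QuantumFields.BalabanUV.Beta.EriceFlowEnclosureB12AsPrintedHistoryContagionShiftFlowZeroTangentWitness
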